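import Literature.AlgebraicGeometry.Frobenioids.ModelFrobenioidBaseSectionThrough
import Literature.AnabelianGeometry.EtaleTheta.BiKummerOfModelCanonical
import Literature.AnabelianGeometry.EtaleTheta.Prop42Sub
import HarnessLib

/-!
# [EtTh] Prop. 4.2 (iii), sub-node L01b `SaturatedRefinement`: reduced to the [FrdII] Rmk. 2.2.1 refinement
# law for the free `(N, H)`-saturation field and the naturality of the Galois surjections (Def. 4.1 (ii))

Mochizuki, *The étale theta function and its Frobenioid-theoretic manifestations*, Publ. RIMS **45**
(2009), §4, Prop. 4.2 (iii), proof PDF p.90 L10–11 [cite: MochizukiEtTh2009, Prop 4.2 p.90]: «[FrdII],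
Remark 2.2.1 [concerning the issue of "(N, H_⊙^{bs-fld})-saturation"]» — the covering carrying an `N`-th
root of `f` is refined to an `(N, H_⊙, f|)`-saturated one (Def. 4.1 (iii): `H_⊙`-ample, `f|` fixed by
`H_A`, (a) linked by pre-steps to a Frobenius-trivial `(N, H_⊙^{bs-fld})`-saturated object, (b) the root).
PROOF-ONLY file (abc-iut cell, writer abc-iut-w4-d044; node `EtTh:Prop4.2(iii)`, sub-DAG row
`EtTh:Prop4.2(iii)/L01b` of `plan/L2/SUBDAG-EtTh-Prop42.md`, owner ∅) over abc-iut-w5-d134's `Prop42Sub.lean`,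
abc-iut-L2-t3's `BiKummerSetting`, abc-iut-L2-t9's `mkOfModelCanonical`, abc-iut-w5-d134's
`ModelFrobenioidBaseSectionThrough.lean` (principal objects) and the [FrdI] Thm. 5.2 bookkeeping of layer L1.
Nothing there is edited; no definition and no named fact is introduced.

**The cut.** At the canonical model the `(N, H_⊙^{bs-fld})`-saturation predicate `IsNHSaturatedBsFld` is a
FREE parameter (`NH`, [FrdII] Def. 2.2 (ii), TODO-merge abc-iut-L1-t4), so `SaturatedRefinement` is not a
theorem there (for `NH := ⊥` it fails as soon as L01a fires). The printed step splits into
* the REFINEMENT LAW `hE` on `NH` (hypothesis; [FrdII] Rmk. 2.2.1 «given `A′ …` there exists a pull-back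
  morphism `A″ → A′` such that `A″` is `(N, H)`-saturated» together with Def. 2.2 (ii) (a) «`μ_N`-saturated»,
  (b) «Galois»; layer L1 PROVES the existence at the arithmetic binding:
  `PadicKummer.existsSaturatedPullback_ofLocalField`) — recorded as GAP-LEDGER row G-w4d044-2;
* the NATURALITY LAW `hS` of the Galois surjections `Π^tp_X ↠ Aut_D(A^bs)` along base morphisms, OUTER form
  (Def. 4.1 (ii) "natural surjective outer homomorphism"; the binder of abc-iut-w5-d013's
  `Sec4GaloisSurjNatural.lean`, typed verbatim; a theorem at `D = B^temp(Π)` in its companion) — it gives the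
  fixedness clause: `H_{A''}` acts over `A_⊙^bs`, since `H_⊙ = Ker(Π ↠ Aut(A_⊙^bs))` is normal;
* a DICTIONARY for the abstract transport `pullFrac` and action `biratAut` (three equations `hpow`, `hcomp`,
  `hfix`: `((−)^birat)^*` is multiplicative and functorial, and an automorphism `σ` of `A` acting over `b`
  fixes `b^* x`) — `rfl`-level for abc-iut-L2-t9's `pullFracModel` / `biratAutModel`
  (`saturatedRefinement_mkOfModelCanonical_of_laws`);
* model bookkeeping PROVED here: pull-back morphisms compose; the refinement of a Frobenius-trivial object along
  a pull-back morphism is Frobenius-trivial (principal, abc-iut-w5-d134's `exists_cls_eq_divB_source`); **every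
  Frobenius-trivial (principal) object of the model Frobenioid is `H_⊙`-AMPLE** — every base automorphism `g`
  lifts to `(1, g, 0, t · (g^* t)⁻¹)` (`exists_aut_baseMap_eq_of_principal`); Def. 4.1 (iii)(a) with the identity
  pre-steps; (b) by transporting the root along the refinement.
HONEST FRAMING: [EtTh]/[FrdII] are refereed prerequisites; typed ≠ proved for `hE`, `hS`; nothing here takes
a side on [IUTchIII] Cor. 3.12.
-/

namespace Literature.AnabelianGeometry.EtaleTheta

open CategoryTheory Opposite Literature.AlgebraicGeometry.Frobenioids

universe u₀ v₀ u v w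

variable {K : Type u₀} [Field K]

namespace BiKummerSetting

variable {X : SemiGraphs.TemperedArithmeticGroup.{u₀} K} {D₀ : Type u₀} [Category.{v₀} D₀]
  {V : FrdIMonoidStub.{w}} {T : RealifiedDivisorMonoids (D₀ := D₀) V} {D : Type u} [Category.{v} D]
  {VD : FrdICatStub.{u, v, w} D} (S : BiKummerSetting X T D VD)

/-! ### Model bookkeeping -/

/-- Pull-back morphisms of the model Frobenioid compose (they are the linear morphisms with `Div = 0`,
[FrdI] Thm. 5.2 (ii); `Φ` divisorial, `B` group-like). [cite: MochizukiFrdI2008, Thm. 5.2(ii) p.101] -/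
theorem isPullback_comp (hΦd : Objectwise (fun M _ => IsDivisorial M) S.tf.divisorMonoid)
    (hBg : Objectwise (fun M _ => IsGroupLike M) S.tf.ratFnFunctor) {A B E : S.C} {ψ : A ⟶ B} {φ : B ⟶ E}
    (hψ : S.IsPullback ψ) (hφ : S.IsPullback φ) : S.IsPullback (ψ ≫ φ) := by
  obtain ⟨hn, hd⟩ := ModelFrobenioid.degFr_div_of_isPullbackMorphism hΦd hψ
  obtain ⟨hn', hd'⟩ := ModelFrobenioid.degFr_div_of_isPullbackMorphism hΦd hφ
  refine ModelFrobenioid.isPullbackMorphism_of hΦd hBg ?_ ?_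
  · rw [ModelFrobenioid.degFr_comp, hn, hn', mul_one]
  · rw [ModelFrobenioid.div_comp_pull, hd', map_one, one_mul, hd, one_pow]

/-- **Every base automorphism of a PRINCIPAL object lifts**: for `A = (A_D, Div_B(t))` and `g ∈ Aut_D(A_D)`
the arrow `(1, g, 0, t · (g^* t)⁻¹)` is an automorphism of `A` over `g` ([FrdI] Thm. 5.1 (iii)
"`Aut`-ampleness" for the model; `B` group-like). [cite: MochizukiFrdI2008, Thm. 5.2(ii) p.101] -/
theorem exists_aut_baseMap_eq_of_principal (hBg : Objectwise (fun M _ => IsGroupLike M) S.tf.ratFnFunctor)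
    {A : S.C} (hA : ∃ b, A.cls = divB S.tf.divisorMonoid S.tf.ratFnFunctor S.tf.divBNatTrans (op A.base) b)
    (g : Aut A.base) : ∃ σ : Aut A, ModelFrobenioid.baseMap σ.hom = g.hom := by
  obtain ⟨b, hb⟩ := hA
  obtain ⟨w, hw⟩ := (hBg A.base).isUnit (pull S.tf.ratFnFunctor g.hom b)
  let lift : A ⟶ A := ModelFrobenioid.mkHom A A 1 g.hom 1 (b * ↑w⁻¹) (by
    rw [PNat.one_coe, pow_one, map_one, mul_one, hb, ModelFrobenioid.pullGp_divB_pull, ← hw, ← map_mul,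
      mul_left_comm, Units.mul_inv, mul_one])
  haveI : IsIso (ModelFrobenioid.baseMap lift) := by
    change IsIso g.hom
    infer_instance
  haveI : IsIso lift := ModelFrobenioid.isIso_of hBg lift rfl rfl
  exact ⟨asIso lift, rfl⟩

/-- **A Frobenius-trivial Galois object of the model Frobenioid is `H_⊙`-ample** (Def. 4.1 (ii)): every element
of `H_A^bs ⊆ Aut_D(A^bs)` lifts to `Aut_C(A)` (indeed every base automorphism does, the object being
principal). [cite: MochizukiEtTh2009, Def 4.1 p.87] -/
theorem isAmple_of_isFrobeniusTrivial (hBg : Objectwise (fun M _ => IsGroupLike M) S.tf.ratFnFunctor)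
    {A : S.C} (hA : S.IsFrobeniusTrivial A) (hG : S.IsGalois A) : S.IsAmple A := by
  refine ⟨hG, fun g _ => ?_⟩
  obtain ⟨σ, hσ⟩ := S.exists_aut_baseMap_eq_of_principal hBg
    (ModelFrobenioid.exists_cls_eq_divB_of_isFrobeniusTrivial A hA) g
  exact ⟨σ, Iso.ext hσ⟩

/-- The refinement of a Frobenius-trivial object along a pull-back morphism is Frobenius-trivial (its class
`Base(ψ)^* α + Div_B(u_ψ)` is principal). [cite: MochizukiFrdI2008, Thm. 5.2 p.101] -/
theorem isFrobeniusTrivial_of_isPullback (hΦd : Objectwise (fun M _ => IsDivisorial M) S.tf.divisorMonoid)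
    (hBg : Objectwise (fun M _ => IsGroupLike M) S.tf.ratFnFunctor) {A' A'' : S.C} {ψ : A'' ⟶ A'}
    (hψ : S.IsPullback ψ) (hA' : S.IsFrobeniusTrivial A') : S.IsFrobeniusTrivial A'' := by
  classical
  obtain ⟨hn, hd⟩ := ModelFrobenioid.degFr_div_of_isPullbackMorphism hΦd hψ
  obtain ⟨b, hb⟩ := ModelFrobenioid.exists_cls_eq_divB_source ψ hn hd
    (ModelFrobenioid.exists_cls_eq_divB_of_isFrobeniusTrivial A' hA')
  let t : ∀ Y : S.C, S.tf.ratFnFunctor.obj (op Y.base) :=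
    Function.update (fun Y : S.C => (1 : S.tf.ratFnFunctor.obj (op Y.base))) A'' b
  have ht : t A'' = b := Function.update_self ..
  exact ModelFrobenioid.isFrobeniusTrivial_of_cls_eq_divB t hBg A'' (by rw [ht]; exact hb)

/-- **Fixedness from the naturality of the Galois surjections** (Def. 4.1 (ii), outer form `hS`): for a
Galois `A` and `σ ∈ H_A` (so `Base(σ) = ρ_{A^bs}(h)` with `h ∈ H_⊙ = Ker(Π ↠ Aut(A_⊙^bs))`, a NORMAL
subgroup), `σ` acts over any base morphism `b : A^bs → A_⊙^bs`: `Base(σ) ≫ b = b`.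
[cite: MochizukiEtTh2009, Def 4.1 p.87] -/
theorem baseMap_comp_eq_of_mem_HA
    (hS : ∀ ⦃A B : D⦄ (hA : S.IsGaloisObj A) (hB : S.IsGaloisObj B) (b : B ⟶ A),
      ∃ c : X.Pi, ∀ g : X.Pi, (S.galoisSurj B hB g).hom ≫ b = b ≫ (S.galoisSurj A hA (c * g * c⁻¹)).hom)
    {A : S.C} (hA : S.IsGalois A) {σ : Aut A} (hσ : σ ∈ S.HA A hA) (b : A.base ⟶ S.Aodot.base) :
    ModelFrobenioid.baseMap σ.hom ≫ b = b := by
  obtain ⟨h, hh, hσh⟩ := Subgroup.mem_map.1 hσ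
  obtain ⟨c, hc⟩ := hS S.isGalois_Aodot hA b
  have hker : S.galoisSurj _ S.isGalois_Aodot (c * h * c⁻¹) = 1 := by
    have hmem : c * h * c⁻¹ ∈ S.Hodot := (MonoidHom.normal_ker _).conj_mem h hh c
    exact hmem
  have hbase : ModelFrobenioid.baseMap σ.hom = (S.galoisSurj A.base hA h).hom := by
    have e := congrArg Iso.hom hσh
    exact e.symm
  rw [hbase, hc h, hker]
  exact Category.comp_id _

namespace Prop42Sub

variable (pullFrac : ∀ {A A' : S.C} (_ : A' ⟶ A), S.biratUnits A → S.biratUnits A')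

/-- **(iii)/L01b `SaturatedRefinement` reduced to the refinement law `hE` and the naturality law `hS`**
(modulo `Φ` divisorial, `B` group-like and the transport dictionary `hpow`/`hcomp`/`hfix`). See the module
docstring. [cite: MochizukiEtTh2009, Prop 4.2 p.90] -/
theorem saturatedRefinement_of_laws (hΦd : Objectwise (fun M _ => IsDivisorial M) S.tf.divisorMonoid)
    (hBg : Objectwise (fun M _ => IsGroupLike M) S.tf.ratFnFunctor)
    (hE : ∀ (N : ℕ+) (A' : S.C), S.IsFrobeniusTrivial A' → S.IsGalois A' →
      ∃ (A'' : S.C) (ψ : A'' ⟶ A'), S.IsPullback ψ ∧ S.IsGalois A'' ∧ S.IsMuSaturated A'' N ∧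
        S.IsNHSaturatedBsFld S.HodotBsFld A'' N)
    (hS : ∀ ⦃A B : D⦄ (hA : S.IsGaloisObj A) (hB : S.IsGaloisObj B) (b : B ⟶ A),
      ∃ c : X.Pi, ∀ g : X.Pi, (S.galoisSurj B hB g).hom ≫ b = b ≫ (S.galoisSurj A hA (c * g * c⁻¹)).hom)
    (hpow : ∀ {A B : S.C} (φ : A ⟶ B) (x : S.biratUnits B) (n : ℕ), pullFrac φ (x ^ n) = pullFrac φ x ^ n)
    (hcomp : ∀ {A B E : S.C} (ψ : A ⟶ B) (φ : B ⟶ E) (x : S.biratUnits E),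
      pullFrac (ψ ≫ φ) x = pullFrac ψ (pullFrac φ x))
    (hfix : ∀ {A : S.C} (σ : Aut A) (b : A ⟶ S.Aodot) (x : S.biratUnits S.Aodot),
      ModelFrobenioid.baseMap σ.hom ≫ ModelFrobenioid.baseMap b = ModelFrobenioid.baseMap b →
        S.biratAut A σ (pullFrac b x) = pullFrac b x) :
    SaturatedRefinement S pullFrac := by
  intro N f A' φ hφ hft hgal hmu hg
  obtain ⟨g, hg⟩ := hg
  obtain ⟨A'', ψ, hψ, hgal'', hmu'', hNH⟩ := hE N A' hft hgal
  have hft'' : S.IsFrobeniusTrivial A'' := S.isFrobeniusTrivial_of_isPullback hΦd hBg hψ hft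
  have hamp : S.IsAmple A'' := S.isAmple_of_isFrobeniusTrivial hBg hft'' hgal''
  refine ⟨A'', ψ, S.isPullback_comp hΦd hBg hψ hφ, hft'', hgal'', hmu'', ⟨hamp, ?_, ?_, ?_⟩⟩
  · -- `f|_{A''}` is fixed by `H_{A''}` (naturality of the Galois surjections)
    intro σ hσ
    exact hfix σ (ψ ≫ φ) f (S.baseMap_comp_eq_of_mem_HA hS hgal'' hσ _)
  · -- Def. 4.1 (iii)(a) with the identity pre-steps
    have hid : S.IsPreStep (𝟙 A'') :=
      ⟨by change ModelFrobenioid.degFr (𝟙 A'') = 1; rfl, by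
        change IsIso (ModelFrobenioid.baseMap (𝟙 A''))
        rw [ModelFrobenioid.baseMap_id]
        infer_instance⟩
    exact ⟨A'', A'', 𝟙 A'', 𝟙 A'', hid, hid, hft'', hNH⟩
  · -- Def. 4.1 (iii)(b): the root transported along the refinement
    refine ⟨pullFrac ψ g, ?_⟩
    rw [← hpow, hg]
    exact (hcomp ψ φ f).symm

end Prop42Sub

section Canonical

variable (X) (tf : TemperedFrobenioid T D VD) (hZ : tf.monoidType = MonoidType.Z)
  (hP : ∀ A : Dᵒᵖ, IsPerfect (tf.Φ.carrier A)) (IG : D → Prop) (gS : ∀ A : D, IG A → (X.Pi →* Aut A))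
  (gSs : ∀ (A : D) (h : IG A), Function.Surjective (gS A h))
  (NH : Subgroup (Field.absoluteGaloisGroup K) → tf.category → ℕ+ → Prop) (A₀ : tf.category)
  (hA₀ : PreFrobenioid.IsFrobeniusTrivial tf.toElem A₀) (hA₀' : IG A₀.base)

/-- **L01b `SaturatedRefinement` for the CANONICAL MODEL INSTANCE, modulo `Φ` divisorial, the refinement law
`hE` for the chosen `(N, H)`-saturation predicate `NH` ([FrdII] Rmk. 2.2.1 + Def. 2.2 (ii)(a)(b)) and the
naturality law `hS` for the chosen Galois surjections `gS` (Def. 4.1 (ii))** — the transport dictionary is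
definitional for abc-iut-L2-t9's `pullFracModel` / `biratAutModel`. [cite: MochizukiEtTh2009, Prop 4.2 p.90] -/
theorem saturatedRefinement_mkOfModelCanonical_of_laws
    (hΦd : Objectwise (fun M _ => IsDivisorial M) tf.divisorMonoid)
    (hE : ∀ (N : ℕ+) (A' : tf.category), PreFrobenioid.IsFrobeniusTrivial tf.toElem A' → IG A'.base →
      ∃ (A'' : tf.category) (ψ : A'' ⟶ A'), PreFrobenioid.IsPullbackMorphism tf.toElem ψ ∧ IG A''.base ∧
        tf.IsMuSaturated A'' N ∧ NH (mkOfModelCanonical X tf hZ hP IG gS gSs NH A₀ hA₀ hA₀').HodotBsFld A'' N)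
    (hS : ∀ ⦃A B : D⦄ (hA : IG A) (hB : IG B) (b : B ⟶ A),
      ∃ c : X.Pi, ∀ g : X.Pi, (gS B hB g).hom ≫ b = b ≫ (gS A hA (c * g * c⁻¹)).hom) :
    Prop42Sub.SaturatedRefinement (mkOfModelCanonical X tf hZ hP IG gS gSs NH A₀ hA₀ hA₀')
      (fun φ x => tf.pullFracModel φ x) := by
  refine Prop42Sub.saturatedRefinement_of_laws (mkOfModelCanonical X tf hZ hP IG gS gSs NH A₀ hA₀ hA₀')
    (fun φ x => tf.pullFracModel φ x) hΦd (tf.isGroupLike_ratFnFunctor T.isUnit_BΛ) hE hS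
    (fun φ x n => map_pow _ x n) (fun ψ φ x => ?_) (@fun A σ b x hb => ?_)
  · apply Units.ext
    rw [TemperedFrobenioid.coe_pullFracModel_apply, TemperedFrobenioid.coe_pullFracModel_apply,
      TemperedFrobenioid.coe_pullFracModel_apply, ModelFrobenioid.baseMap_comp, op_comp, Functor.map_comp]
    rfl
  · have hb' : ModelFrobenioid.baseMap σ.inv ≫ ModelFrobenioid.baseMap b = ModelFrobenioid.baseMap b :=
      calc ModelFrobenioid.baseMap σ.inv ≫ ModelFrobenioid.baseMap b
          = ModelFrobenioid.baseMap σ.inv ≫ ModelFrobenioid.baseMap σ.hom ≫ ModelFrobenioid.baseMap b := by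
            rw [hb]
        _ = ModelFrobenioid.baseMap b := by
            rw [← Category.assoc, ← ModelFrobenioid.baseMap_comp, Iso.inv_hom_id, ModelFrobenioid.baseMap_id,
              Category.id_comp]
    apply Units.ext
    change ((tf.biratAutModel A σ (tf.pullFracModel b x) : tf.biratUnitsModel A) :
        tf.ratFnFunctor.obj (op A.base)) =
      ((tf.pullFracModel b x : tf.biratUnitsModel A) : tf.ratFnFunctor.obj (op A.base))
    rw [TemperedFrobenioid.coe_biratAutModel_apply, TemperedFrobenioid.coe_pullFracModel_apply,
      ← CategoryTheory.comp_apply, ← Functor.map_comp, ← op_comp, hb']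

end Canonical

end BiKummerSetting

end Literature.AnabelianGeometry.EtaleTheta
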